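import Summits.PneNP.PneNP.Theorems.ChebyshevTracialDesignHSModeParseval
import Summits.PneNP.PneNP.Theorems.ChebyshevTracialDesignProjectionNormalForm
import HarnessLib

/-!
# Cell pnp-psdrank, route `ChebyshevTracialDesign`: the WHITENED Hilbert–Schmidt mode bound — the higher bi-modes of a matrix strategy are
# controlled by the OVERLAP `tr(X̄Ȳ)` times OPERATOR-NORM layer energies of the whitened sides, uniformly in the dimension `r`

Harmonic backbone of the crux `TracialDecayExp20` (stmt-PneNP-19878), brick 87 (prover g16; MEMO-19 §2). Brick 45b
(`…VirtualBimodePsd.virtual_psd_mul_eq`) writes the virtual value of a matrix strategy `(X, Y)` of dimension `r` as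
`overlap + re-weighted tight modes`: the `κ = 0` term is `N₁·|PM|·tr(X̄Ȳ)` and the modes are `C_κ = Σ_M tr(H_M Y_M)`,
`H_M[a,b] = col_{2κ}(M; p^{ab})` (tight column sums of the entrywise harmonic layers of `X`); its docstring records "the ONE place where the
r = 1 argument (brick 46: 'the constant mode wins') does not lift to psd": brick 45d's Hilbert–Schmidt Cauchy–Schwarz
`C_κ² ≤ (Σ_M‖Y_M‖_F²)(Σ_U‖X̃_U‖_F²)·λ_{2κ}` compares the modes with the TRACE densities, which are decoupled from the overlap `tr(X̄Ȳ)`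
(misaligned strategies). This file repairs exactly that step. WHITENING: write `X_U = S A_U Sᵀ`, `Y_M = T B_M Tᵀ` (e.g. `SSᵀ = X̄`, `TTᵀ = Ȳ`);
then `tr(X_U Y_M) = tr(A_U C B_M Cᵀ)` with `C = SᵀT`, `tr(CᵀC) = tr(SSᵀ·TTᵀ) = tr(X̄Ȳ)` (§2), and for ANY kernel `k(U,M)` (§1):

  `(Σ_{U,M} k(U,M)·tr(A_U C B_M Cᵀ))² ≤ Λ·α·β·tr(CᵀC)²`                                             (`whitened_bilinear_sq_le`)

whenever `Σ_M (Σ_U k(U,M) a(U))² ≤ Λ·Σ_U a(U)²` for the scalar functions `a = (A_·C)_{il}`, `Σ_U A_UᵀA_U ⪯ α·I` and `Σ_M B_MᵀB_M ⪯ β·I`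
(OPERATOR-norm energies — no trace over `r` coordinates, no factor `r`). §3: for a whitened contraction side (`0 ⪯ A_U ⪯ K·I`,
`Σ_U A_U = N·I`) the trivial energy bound is `Σ_U A_U² ⪯ K·N·I` (`sum_sq_le_of_contraction_family`), `K = 1/λ_min(X̄)`. §4: in the tree's
harmonic vocabulary (tight incidence `1[cc(U,M) = 1]` on the `t`-cuts, Gram class function `κ₁`, harmonic data `q^{ab}` of degree `j`,
`Λ = kernelEigen n t j κ₁` by `sum_sq_gram_ladder`): **`whitened_HSmode_sq_le`** —
`(Σ_M tr(Ĥ_M C B_M Cᵀ))² ≤ λ_j·α·β·tr(CᵀC)²`, `Ĥ_M[a,b] = col_j(M; q^{ab})`, `Σ_{|U|=t} Q̃_UᵀQ̃_U ⪯ αI` for the layer matrices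
`Q̃_U[a,b] = ((Wᵀ)^{t−j}q^{ab})(U)`, `Σ_M B_MᵀB_M ⪯ βI` — the r-UNIFORM replacement of brick 45d's `HSmode_sq_le`.
CONSEQUENCE (MEMO-19 §2; the assembly with brick 45b is left to its consumer): for `X̄ = SSᵀ ≻ 0`, `Ȳ = TTᵀ ≻ 0` take the whitened data
`q = S⁻¹pS⁻ᵀ`, `B_M = T⁻¹Y_MT⁻ᵀ`, `C = SᵀT`; then 45b's mode `C_κ = Σ_M tr(H_M Y_M)` is the left side of `whitened_HSmode_sq_le`
(`trace_dewhiten`), `tr(CᵀC) = tr(X̄Ȳ)` (`trace_whiten_overlap`), `β ≤ |PM|/λ_min(Ȳ)` and `α ≤ C(n,t)/λ_min(X̄)` (§3 with layer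
orthogonality), and `λ_{2κ} ≤ |PM|·N₁²·A_κ/C(n,t)` (45d `kernelEigen_tight_even_le`, `A_κ = Π_{i<κ}(2i+1)/(n−2i)`), whence
`|C_κ| ≤ N₁·|PM|·tr(X̄Ȳ)·√(A_κ/(λ_min(X̄)·λ_min(Ȳ)))` against the `κ = 0` term `N₁·|PM|·tr(X̄Ȳ)`: the overlap DOMINATES the re-weighted
modes, and the virtual value is `≥ 0`, for every pair of contraction fields with `λ_min(X̄)·λ_min(Ȳ) ≥ c/n` (`c` absolute), at EVERY
dimension `r` — the psd form of the dense regime of the `r = 1` rung. The open content of the crux is thereby the DIRECTIONALLY SPARSE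
regime (a direction in which `X̄` or `Ȳ` has density `≲ n^{−1/2}`), the analogue of the sparse sets that the Kupavskii–Zakharov /
Keevash–Lifshitz structure handles at `r = 1`.
[cite: BrouwerHaemers2012, Thm. 4.9.1 (PDF p. 93)] [cite: MacWilliamsSloane1977, Ch. 21 §6 Thm. 10 (PDF p. 516)] [cite: GriblingDelaatLaurent2019, §5]
[cite: Rothvoss2017, §2 (PDF p. 6)]
Stature: support/instrument (no defs, kernel lane). WHAT THIS IS NOT: not virtual nonnegativity in the sparse regime, not the crux, nothing on
psd rank of P_PM(K_n), no P-vs-NP content. Supports stmt-PneNP-19878.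
-/

set_option linter.dupNamespace false -- `Summit.PneNP.PneNP.…`: summit = sub-problem (D-0017)

noncomputable section

namespace Summit.PneNP.PneNP.Theorems.ChebyshevTracialDesignWhitenedModeBound

open Finset Matrix Literature.Barriers.PneNP Literature.Combinatorics.Optimization
open Literature.Combinatorics.AssociationSchemes Literature.Combinatorics.AssociationSchemes.JohnsonHarmonics
open Literature.Combinatorics.AssociationSchemes.JohnsonSpectrum
open Summit.PneNP.PneNP.Theorems.ChebyshevTracialDesignCommutative (posSemidef_conj one_sub_conj conj_mul_conj trace_conj)
open Summit.PneNP.PneNP.Theorems.ChebyshevTracialDesignProjectionNormalForm (exists_eigenbasis unitInterval_of_conj)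
open Summit.PneNP.PneNP.Theorems.ChebyshevTracialDesignHSModeParseval (sq_sum_sqrt_mul_sqrt_le)

variable {n r : ℕ}

/-! ### §1 The whitened Cauchy–Schwarz bound for matrix-weighted bilinear sums -/

/-- `tr(P Q) = Σ_{i,l} P_{il}·(Qᵀ)_{il}`. [folklore] -/
theorem trace_mul_eq_sum_mul_transpose (P Q : Matrix (Fin r) (Fin r) ℝ) :
    (P * Q).trace = ∑ il : Fin r × Fin r, P il.1 il.2 * Qᵀ il.1 il.2 := by
  rw [← Finset.univ_product_univ, Finset.sum_product]
  simp only [Matrix.trace, Matrix.diag_apply, Matrix.mul_apply, Matrix.transpose_apply]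

/-- `tr(A C B Cᵀ) = Σ_{i,l} (A C)_{il}·(C Bᵀ)_{il}`. [folklore] -/
theorem trace_four_eq_sum (A C B : Matrix (Fin r) (Fin r) ℝ) :
    (A * C * B * Cᵀ).trace = ∑ il : Fin r × Fin r, (A * C) il.1 il.2 * (C * Bᵀ) il.1 il.2 := by
  rw [show A * C * B * Cᵀ = (A * C) * (B * Cᵀ) by simp only [Matrix.mul_assoc], trace_mul_eq_sum_mul_transpose,
    Matrix.transpose_mul, Matrix.transpose_transpose]

/-- The squared Frobenius norm is a trace: `Σ_{i,l} P_{il}² = tr(Pᵀ P)`. [folklore] -/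
theorem sum_sq_eq_trace_transpose_mul (P : Matrix (Fin r) (Fin r) ℝ) :
    ∑ il : Fin r × Fin r, P il.1 il.2 ^ 2 = (Pᵀ * P).trace := by
  rw [← Finset.univ_product_univ, Finset.sum_product, Finset.sum_comm]
  simp only [Matrix.trace, Matrix.diag_apply, Matrix.mul_apply, Matrix.transpose_apply, sq]

/-- `tr(Q P) ≤ β·tr(P)` for `P ⪰ 0` and `Q ⪯ β·I`. [folklore] -/
theorem trace_mul_le_of_le_smul {P Q : Matrix (Fin r) (Fin r) ℝ} (hP : P.PosSemidef) {β : ℝ}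
    (hQ : (β • (1 : Matrix (Fin r) (Fin r) ℝ) - Q).PosSemidef) : (Q * P).trace ≤ β * P.trace := by
  have h : 0 ≤ ((β • (1 : Matrix (Fin r) (Fin r) ℝ) - Q) * P).trace :=
    (show HasPsdFactorization (fun (_ : Unit) (_ : Unit) => ((β • (1 : Matrix (Fin r) (Fin r) ℝ) - Q) * P).trace) r from
      ⟨fun _ => _, fun _ => P, fun _ => hQ, fun _ => hP, fun _ _ => rfl⟩).nonneg () ()
  rw [Matrix.sub_mul, Matrix.smul_mul, Matrix.one_mul, trace_sub, trace_smul, smul_eq_mul] at h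
  linarith

/-- **Energy of the left factors through `C`**: `Σ_U ‖A_U C‖_F² ≤ α·tr(CᵀC)` if `Σ_U A_UᵀA_U ⪯ α·I`. [folklore] -/
theorem sum_frob_mul_le {σ : Type*} (s : Finset σ) (A : σ → Matrix (Fin r) (Fin r) ℝ) (C : Matrix (Fin r) (Fin r) ℝ) {α : ℝ}
    (hA : (α • (1 : Matrix (Fin r) (Fin r) ℝ) - ∑ U ∈ s, (A U)ᵀ * A U).PosSemidef) :
    ∑ U ∈ s, ∑ il : Fin r × Fin r, (A U * C) il.1 il.2 ^ 2 ≤ α * (Cᵀ * C).trace := by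
  have e : ∀ U, ∑ il : Fin r × Fin r, (A U * C) il.1 il.2 ^ 2 = (((A U)ᵀ * A U) * (C * Cᵀ)).trace := fun U => by
    rw [sum_sq_eq_trace_transpose_mul, Matrix.transpose_mul]
    rw [show Cᵀ * (A U)ᵀ * (A U * C) = Cᵀ * ((A U)ᵀ * A U * C) by simp only [Matrix.mul_assoc], Matrix.trace_mul_comm,
      Matrix.mul_assoc]
  simp_rw [e]
  rw [← trace_sum, ← Finset.sum_mul]
  have hCC : (C * Cᵀ).PosSemidef := by
    simpa [conjTranspose_eq_transpose_of_trivial] using Matrix.posSemidef_self_mul_conjTranspose C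
  calc (((∑ U ∈ s, (A U)ᵀ * A U)) * (C * Cᵀ)).trace ≤ α * (C * Cᵀ).trace := trace_mul_le_of_le_smul hCC hA
    _ = α * (Cᵀ * C).trace := by rw [Matrix.trace_mul_comm]

/-- **Energy of the right factors through `C`**: `Σ_M ‖C B_Mᵀ‖_F² ≤ β·tr(CᵀC)` if `Σ_M B_MᵀB_M ⪯ β·I`. [folklore] -/
theorem sum_frob_mul_transpose_le {τ : Type*} [Fintype τ] (B : τ → Matrix (Fin r) (Fin r) ℝ) (C : Matrix (Fin r) (Fin r) ℝ) {β : ℝ}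
    (hB : (β • (1 : Matrix (Fin r) (Fin r) ℝ) - ∑ M, (B M)ᵀ * B M).PosSemidef) :
    ∑ M, ∑ il : Fin r × Fin r, (C * (B M)ᵀ) il.1 il.2 ^ 2 ≤ β * (Cᵀ * C).trace := by
  have e : ∀ M, ∑ il : Fin r × Fin r, (C * (B M)ᵀ) il.1 il.2 ^ 2 = (((B M)ᵀ * B M) * (Cᵀ * C)).trace := fun M => by
    rw [sum_sq_eq_trace_transpose_mul, Matrix.transpose_mul, Matrix.transpose_transpose]
    rw [show B M * Cᵀ * (C * (B M)ᵀ) = (B M * (Cᵀ * C)) * (B M)ᵀ by simp only [Matrix.mul_assoc], Matrix.trace_mul_comm,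
      ← Matrix.mul_assoc]
  simp_rw [e]
  rw [← trace_sum, ← Finset.sum_mul]
  have hCC : (Cᵀ * C).PosSemidef := by
    simpa [conjTranspose_eq_transpose_of_trivial] using Matrix.posSemidef_conjTranspose_mul_self C
  exact trace_mul_le_of_le_smul hCC hB

/-- **THE WHITENED CAUCHY–SCHWARZ BOUND.** For a kernel `k` on `s × τ`, matrix families `A_U`, `B_M`, a matrix `C`, and constants with
`Σ_M (Σ_{U∈s} k(U,M)·(A_U C)_{il})² ≤ Λ·Σ_{U∈s} (A_U C)_{il}²` for every entry `(i,l)` (`Λ` = squared operator norm of `k` on the relevant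
functions), `Σ_U A_UᵀA_U ⪯ α·I`, `Σ_M B_MᵀB_M ⪯ β·I`:
`(Σ_{U∈s} Σ_M k(U,M)·tr(A_U C B_M Cᵀ))² ≤ Λ·α·β·tr(CᵀC)²`. Uniform in the dimension: only `tr(CᵀC)` (the overlap after whitening) and
operator-norm energies enter. [cite: BrouwerHaemers2012, Thm. 4.9.1 (PDF p. 93)] [cite: GriblingDelaatLaurent2019, §5] -/
theorem whitened_bilinear_sq_le {σ τ : Type*} [Fintype τ] (s : Finset σ) (k : σ → τ → ℝ)
    (A : σ → Matrix (Fin r) (Fin r) ℝ) (B : τ → Matrix (Fin r) (Fin r) ℝ) (C : Matrix (Fin r) (Fin r) ℝ) {Λ α β : ℝ}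
    (hΛ : 0 ≤ Λ)
    (hk : ∀ il : Fin r × Fin r, ∑ M, (∑ U ∈ s, k U M * (A U * C) il.1 il.2) ^ 2 ≤ Λ * ∑ U ∈ s, (A U * C) il.1 il.2 ^ 2)
    (hA : (α • (1 : Matrix (Fin r) (Fin r) ℝ) - ∑ U ∈ s, (A U)ᵀ * A U).PosSemidef)
    (hB : (β • (1 : Matrix (Fin r) (Fin r) ℝ) - ∑ M, (B M)ᵀ * B M).PosSemidef) :
    (∑ U ∈ s, ∑ M, k U M * (A U * C * B M * Cᵀ).trace) ^ 2 ≤ Λ * α * β * (Cᵀ * C).trace ^ 2 := by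
  -- entry functions
  set a : σ → Fin r × Fin r → ℝ := fun U il => (A U * C) il.1 il.2 with ha
  set b : τ → Fin r × Fin r → ℝ := fun M il => (C * (B M)ᵀ) il.1 il.2 with hb
  set g : Fin r × Fin r → τ → ℝ := fun il M => ∑ U ∈ s, k U M * a U il with hg
  -- regroup the bilinear sum entry by entry
  have hS : ∑ U ∈ s, ∑ M, k U M * (A U * C * B M * Cᵀ).trace = ∑ il : Fin r × Fin r, ∑ M, b M il * g il M := by
    calc ∑ U ∈ s, ∑ M, k U M * (A U * C * B M * Cᵀ).trace
        = ∑ U ∈ s, ∑ M, ∑ il : Fin r × Fin r, k U M * (a U il * b M il) := by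
          refine sum_congr rfl fun U _ => sum_congr rfl fun M _ => ?_
          rw [trace_four_eq_sum, mul_sum]
      _ = ∑ U ∈ s, ∑ il : Fin r × Fin r, ∑ M, k U M * (a U il * b M il) :=
          sum_congr rfl fun U _ => sum_comm
      _ = ∑ il : Fin r × Fin r, ∑ U ∈ s, ∑ M, k U M * (a U il * b M il) := sum_comm
      _ = ∑ il : Fin r × Fin r, ∑ M, ∑ U ∈ s, k U M * (a U il * b M il) :=
          sum_congr rfl fun il _ => sum_comm
      _ = ∑ il : Fin r × Fin r, ∑ M, b M il * g il M := by
          refine sum_congr rfl fun il _ => sum_congr rfl fun M _ => ?_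
          rw [hg, mul_sum]
          exact sum_congr rfl fun U _ => by ring
  -- energies
  set u : Fin r × Fin r → ℝ := fun il => ∑ M, b M il ^ 2 with hu
  set v : Fin r × Fin r → ℝ := fun il => Λ * ∑ U ∈ s, a U il ^ 2 with hv
  have hu0 : ∀ il, 0 ≤ u il := fun il => sum_nonneg fun M _ => sq_nonneg _
  have hv0 : ∀ il, 0 ≤ v il := fun il => mul_nonneg hΛ (sum_nonneg fun U _ => sq_nonneg _)
  -- termwise Cauchy–Schwarz in `M`, then the kernel bound
  have hterm : ∀ il, |∑ M, b M il * g il M| ≤ Real.sqrt (u il) * Real.sqrt (v il) := by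
    intro il
    have h1 : |∑ M, b M il * g il M| ≤ Real.sqrt ((∑ M, b M il ^ 2) * ∑ M, g il M ^ 2) :=
      Real.abs_le_sqrt (sum_mul_sq_le_sq_mul_sq univ _ _)
    refine h1.trans ?_
    rw [← Real.sqrt_mul (hu0 il)]
    exact Real.sqrt_le_sqrt (mul_le_mul_of_nonneg_left (hk il) (hu0 il))
  have habs : |∑ il : Fin r × Fin r, ∑ M, b M il * g il M| ≤ ∑ il : Fin r × Fin r, Real.sqrt (u il) * Real.sqrt (v il) :=
    (abs_sum_le_sum_abs _ _).trans (sum_le_sum fun il _ => hterm il)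
  -- total energies through `C`
  have hU : ∑ il : Fin r × Fin r, u il ≤ β * (Cᵀ * C).trace := by
    rw [hu, sum_comm]; exact sum_frob_mul_transpose_le B C hB
  have hV : ∑ il : Fin r × Fin r, v il ≤ Λ * (α * (Cᵀ * C).trace) := by
    rw [hv, ← mul_sum, sum_comm]; exact mul_le_mul_of_nonneg_left (sum_frob_mul_le s A C hA) hΛ
  calc (∑ U ∈ s, ∑ M, k U M * (A U * C * B M * Cᵀ).trace) ^ 2
      = |∑ il : Fin r × Fin r, ∑ M, b M il * g il M| ^ 2 := by rw [hS, sq_abs]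
    _ ≤ (∑ il : Fin r × Fin r, Real.sqrt (u il) * Real.sqrt (v il)) ^ 2 := pow_le_pow_left₀ (abs_nonneg _) habs 2
    _ ≤ (∑ il : Fin r × Fin r, u il) * ∑ il : Fin r × Fin r, v il :=
        sq_sum_sqrt_mul_sqrt_le univ u v (fun il _ => hu0 il) (fun il _ => hv0 il)
    _ ≤ (β * (Cᵀ * C).trace) * (Λ * (α * (Cᵀ * C).trace)) :=
        mul_le_mul hU hV (sum_nonneg fun il _ => hv0 il) ((sum_nonneg fun il _ => hu0 il).trans hU)
    _ = Λ * α * β * (Cᵀ * C).trace ^ 2 := by ring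

/-! ### §2 Whitening identities -/

/-- **Whitening the trace pairing**: `tr((S A Sᵀ)(T B Tᵀ)) = tr(A C B Cᵀ)` with `C = SᵀT`. [folklore] -/
theorem trace_dewhiten (S A T B : Matrix (Fin r) (Fin r) ℝ) :
    ((S * A * Sᵀ) * (T * B * Tᵀ)).trace = (A * (Sᵀ * T) * B * (Sᵀ * T)ᵀ).trace := by
  rw [Matrix.transpose_mul, Matrix.transpose_transpose]
  rw [show S * A * Sᵀ * (T * B * Tᵀ) = S * (A * (Sᵀ * T) * B * Tᵀ) by simp only [Matrix.mul_assoc], Matrix.trace_mul_comm]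
  simp only [Matrix.mul_assoc]

/-- **The overlap after whitening**: `tr(CᵀC) = tr((SSᵀ)(TTᵀ))` for `C = SᵀT` — with `SSᵀ = X̄`, `TTᵀ = Ȳ` this is the overlap `tr(X̄Ȳ)`.
[folklore] -/
theorem trace_whiten_overlap (S T : Matrix (Fin r) (Fin r) ℝ) :
    ((Sᵀ * T)ᵀ * (Sᵀ * T)).trace = ((S * Sᵀ) * (T * Tᵀ)).trace := by
  rw [Matrix.transpose_mul, Matrix.transpose_transpose]
  rw [show Tᵀ * S * (Sᵀ * T) = Tᵀ * (S * Sᵀ * T) by simp only [Matrix.mul_assoc], Matrix.trace_mul_comm]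
  simp only [Matrix.mul_assoc]

/-! ### §3 The trivial operator-norm energy of a whitened contraction family -/

/-- `K·I = diag(K, …, K)`. [folklore] -/
theorem smul_one_eq_diagonal (K : ℝ) : K • (1 : Matrix (Fin r) (Fin r) ℝ) = diagonal fun _ => K := by
  rw [← diagonal_one, ← diagonal_smul]
  congr 1
  funext i
  simp

/-- `A² ⪯ K·A` for `0 ⪯ A ⪯ K·I`: in an eigenbasis, `λ² ≤ Kλ` for `λ ∈ [0, K]`. [folklore] -/
theorem mul_self_le_smul {A : Matrix (Fin r) (Fin r) ℝ} (h0 : A.PosSemidef) {K : ℝ}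
    (h1 : (K • (1 : Matrix (Fin r) (Fin r) ℝ) - A).PosSemidef) : (K • A - A * A).PosSemidef := by
  obtain ⟨O, x, hO, hA⟩ := exists_eigenbasis h0.1
  -- eigenvalues in `[0, K]`
  have hOXO : Oᵀ * A * (Oᵀ)ᵀ = diagonal x := by
    rw [hA, transpose_transpose]
    calc Oᵀ * (O * diagonal x * Oᵀ) * O = (Oᵀ * O) * diagonal x * (Oᵀ * O) := by simp only [Matrix.mul_assoc]
      _ = diagonal x := by rw [hO, Matrix.one_mul, Matrix.mul_one]
  have hx0 : ∀ i, 0 ≤ x i := fun i => by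
    have h := posSemidef_conj h0 Oᵀ
    rw [hOXO] at h
    exact posSemidef_diagonal_iff.1 h i
  have hxK : ∀ i, x i ≤ K := fun i => by
    have h := posSemidef_conj h1 Oᵀ
    have e : Oᵀ * (K • (1 : Matrix (Fin r) (Fin r) ℝ) - A) * (Oᵀ)ᵀ = diagonal fun i => K - x i := by
      rw [Matrix.mul_sub, Matrix.sub_mul, hOXO, transpose_transpose, Matrix.mul_smul, Matrix.mul_one, Matrix.smul_mul, hO,
        smul_one_eq_diagonal, diagonal_sub]
    rw [e] at h
    have := posSemidef_diagonal_iff.1 h i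
    linarith
  -- `K·A − A² = O·diag(Kx − x²)·Oᵀ`
  have h1' : K • A = O * diagonal (fun i => K * x i) * Oᵀ := by
    calc K • A = K • (O * diagonal x * Oᵀ) := by rw [hA]
      _ = O * (K • diagonal x) * Oᵀ := by rw [Matrix.mul_smul, Matrix.smul_mul]
      _ = O * diagonal (fun i => K * x i) * Oᵀ := by rw [← diagonal_smul]; rfl
  have h2' : A * A = O * diagonal (fun i => x i * x i) * Oᵀ := by rw [hA, conj_mul_conj _ _ _ hO, diagonal_mul_diagonal]
  have e : K • A - A * A = O * diagonal (fun i => K * x i - x i * x i) * Oᵀ := by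
    rw [h1', h2', ← Matrix.sub_mul, ← Matrix.mul_sub, diagonal_sub]
  rw [e]
  exact posSemidef_conj (PosSemidef.diagonal fun i => (by nlinarith [hx0 i, hxK i] : (0 : ℝ) ≤ K * x i - x i * x i)) O

/-- `A² ⪯ A` for a psd contraction `0 ⪯ A ⪯ I`. [folklore] -/
theorem mul_self_le_of_contraction {A : Matrix (Fin r) (Fin r) ℝ} (h0 : A.PosSemidef) (h1 : (1 - A).PosSemidef) :
    (A - A * A).PosSemidef := by
  have h := mul_self_le_smul h0 (K := 1) (by rwa [one_smul])
  rwa [one_smul] at h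

/-- **Trivial energy of a whitened contraction family**: if `A_U` are symmetric with `0 ⪯ A_U ⪯ K·I` (`K > 0`) and `Σ_{U∈s} A_U ⪯ N·I`, then
`Σ_{U∈s} A_UᵀA_U ⪯ K·N·I` (`K ≥ 0`). (For the whitened cut side `A_U = X̄^{−1/2}X_UX̄^{−1/2}`: `K = 1/λ_min(X̄)`, `N = #cuts`.) [folklore] -/
theorem sum_sq_le_of_contraction_family {σ : Type*} (s : Finset σ) (A : σ → Matrix (Fin r) (Fin r) ℝ)
    (h0 : ∀ U ∈ s, (A U).PosSemidef) {K N : ℝ} (hK : 0 ≤ K) (h1 : ∀ U ∈ s, (K • (1 : Matrix (Fin r) (Fin r) ℝ) - A U).PosSemidef)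
    (hN : (N • (1 : Matrix (Fin r) (Fin r) ℝ) - ∑ U ∈ s, A U).PosSemidef) :
    ((K * N) • (1 : Matrix (Fin r) (Fin r) ℝ) - ∑ U ∈ s, (A U)ᵀ * A U).PosSemidef := by
  have hsym : ∀ U ∈ s, (A U)ᵀ = A U := fun U hU => by
    have h := (h0 U hU).1
    rwa [IsHermitian, conjTranspose_eq_transpose_of_trivial] at h
  have hstep : ((K • ∑ U ∈ s, A U) - ∑ U ∈ s, (A U)ᵀ * A U).PosSemidef := by
    rw [Finset.smul_sum, ← Finset.sum_sub_distrib]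
    refine posSemidef_sum (s := s) fun U hU => ?_
    rw [hsym U hU]
    exact mul_self_le_smul (h0 U hU) (h1 U hU)
  have h2 : ((K * N) • (1 : Matrix (Fin r) (Fin r) ℝ) - K • ∑ U ∈ s, A U).PosSemidef := by
    have := hN.smul hK
    rwa [smul_sub, smul_smul] at this
  have := h2.add hstep
  rwa [sub_add_sub_cancel] at this

/-! ### §4 The whitened Hilbert–Schmidt mode bound in the harmonic vocabulary -/

/-- The layer matrices `Q̃_U[a,b] = ((Wᵀ)^{t−j} q^{ab})(U)` pushed through `C`: `(Q̃_U C)[i,l] = ((Wᵀ)^{t−j} q'^{il})(U)` with the combined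
harmonic data `q'^{il} = Σ_b C[b,l]·q^{ib}`. [cite: MacWilliamsSloane1977, Ch. 21 §6 Thm. 10 (PDF p. 516)] -/
theorem layerMatrix_mul_apply {t j : ℕ} (q : Fin r × Fin r → Finset (Fin n) → ℝ) (C : Matrix (Fin r) (Fin r) ℝ)
    (U : Finset (Fin n)) (i l : Fin r) :
    ((Matrix.of fun a b => (up^[t - j] (q (a, b))) U) * C) i l = (up^[t - j] (∑ b : Fin r, C b l • q (i, b))) U := by
  rw [iterate_up_sum, Finset.sum_apply, Matrix.mul_apply]
  refine sum_congr rfl fun b _ => ?_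
  rw [iterate_up_smul, Pi.smul_apply, smul_eq_mul, Matrix.of_apply, mul_comm]

/-- **THE WHITENED HS-MODE BOUND.** For harmonic data `q^{ab}` of degree `j ≤ t` (the entrywise layer-`j` data of a — typically whitened —
cut side), the tight incidence with Gram class function `κ₁` on the `t`-cuts, a matrix family `B` on the perfect matchings with
`Σ_M B_MᵀB_M ⪯ β·I`, any `C`, and any `α` with `Σ_{|U|=t} Q̃_UᵀQ̃_U ⪯ α·I` (`Q̃_U[a,b] = ((Wᵀ)^{t−j}q^{ab})(U)`):
`(Σ_M tr(Ĥ_M C B_M Cᵀ))² ≤ kernelEigen n t j κ₁ · α · β · tr(CᵀC)²`, where `Ĥ_M = Σ_{|U|=t} 1[cc(U,M)=1]·Q̃_U`. With `C = I`, `B = Y` this is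
weaker than brick 45d's `HSmode_sq_le`; with `C = X̄^{1/2}Ȳ^{1/2}` and whitened sides it is the r-uniform bound by the overlap.
[cite: BrouwerHaemers2012, Thm. 4.9.1 (PDF p. 93)] [cite: MacWilliamsSloane1977, Ch. 21 §6 Thm. 10 (PDF p. 516)] [cite: GriblingDelaatLaurent2019, §5] -/
theorem whitened_HSmode_sq_le {t j : ℕ} (hjt : j ≤ t) (q : Fin r × Fin r → Finset (Fin n) → ℝ) (hq : ∀ ab, IsHarmonic j (q ab))
    (κ₁ : ℕ → ℝ)
    (hA1 : ∀ U ∈ univ.powersetCard t, ∀ U' ∈ univ.powersetCard t,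
      ∑ M : PMatch n, (if (U.filter fun x => M.2.partner x ∉ U).card = 1 then (1 : ℝ) else 0) *
        (if (U'.filter fun x => M.2.partner x ∉ U').card = 1 then (1 : ℝ) else 0) = κ₁ (U ∩ U').card)
    (hΛ : 0 ≤ kernelEigen n t j κ₁)
    (B : PMatch n → Matrix (Fin r) (Fin r) ℝ) (C : Matrix (Fin r) (Fin r) ℝ) {α β : ℝ}
    (hA : (α • (1 : Matrix (Fin r) (Fin r) ℝ) -
      ∑ U ∈ univ.powersetCard t, (Matrix.of fun a b => (up^[t - j] (q (a, b))) U)ᵀ *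
        (Matrix.of fun a b => (up^[t - j] (q (a, b))) U)).PosSemidef)
    (hB : (β • (1 : Matrix (Fin r) (Fin r) ℝ) - ∑ M, (B M)ᵀ * B M).PosSemidef) :
    (∑ U ∈ univ.powersetCard t, ∑ M : PMatch n, (if (U.filter fun x => M.2.partner x ∉ U).card = 1 then (1 : ℝ) else 0) *
        ((Matrix.of fun a b => (up^[t - j] (q (a, b))) U) * C * B M * Cᵀ).trace) ^ 2 ≤
      kernelEigen n t j κ₁ * α * β * (Cᵀ * C).trace ^ 2 := by
  refine whitened_bilinear_sq_le (univ.powersetCard t)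
    (fun U (M : PMatch n) => if (U.filter fun x => M.2.partner x ∉ U).card = 1 then (1 : ℝ) else 0)
    (fun U => Matrix.of fun a b => (up^[t - j] (q (a, b))) U) B C hΛ (fun il => ?_) hA hB
  -- the kernel bound on the entry functions: Gram identity on the combined harmonic data
  set q' : Finset (Fin n) → ℝ := ∑ b : Fin r, C b il.2 • q (il.1, b) with hq'
  have hq'h : IsHarmonic j q' := IsHarmonic.sum _ fun b _ => (hq (il.1, b)).smul _
  have happ : ∀ U, ((Matrix.of fun a b => (up^[t - j] (q (a, b))) U) * C) il.1 il.2 = (up^[t - j] q') U :=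
    fun U => layerMatrix_mul_apply q C U il.1 il.2
  simp_rw [happ]
  have hgram := sum_sq_gram_ladder hjt
    (fun U (M : PMatch n) => if (U.filter fun x => M.2.partner x ∉ U).card = 1 then (1 : ℝ) else 0) κ₁ hA1 hq'h
  have e1 : ∑ M : PMatch n, (∑ U ∈ univ.powersetCard t,
      (if (U.filter fun x => M.2.partner x ∉ U).card = 1 then (1 : ℝ) else 0) * (up^[t - j] q') U) ^ 2 =
      kernelEigen n t j κ₁ * ip (up^[t - j] q') (up^[t - j] q') := by
    rw [← hgram]
    exact sum_congr rfl fun M _ => by rw [sum_congr rfl fun U _ => mul_comm _ _]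
  -- `ip` of a degree-`t` homogeneous function is its energy on the `t`-sets
  have hhom : IsHomog t (up^[t - j] q') := by
    have h := isHomog_iterate_up hq'h.1 (t - j)
    rwa [Nat.add_sub_cancel' hjt] at h
  have e2 : ip (up^[t - j] q') (up^[t - j] q') = ∑ U ∈ univ.powersetCard t, (up^[t - j] q') U ^ 2 := by
    rw [ip]
    rw [← Finset.sum_subset (Finset.subset_univ (univ.powersetCard t)) fun U _ hU => by
      rw [hhom U fun h => hU (Finset.mem_powersetCard.2 ⟨Finset.subset_univ _, h⟩), mul_zero]]
    exact sum_congr rfl fun U _ => by rw [sq]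
  rw [e1, e2]

end Summit.PneNP.PneNP.Theorems.ChebyshevTracialDesignWhitenedModeBound

end
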